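import Summits.QuantumAdvantage.QuantumAdvantage.Theorems.SosSandwichTransferPBMachineReductionPot
import HarnessLib

/-!
# Crux `TransferPB` (stmt-QuantumAdvantage-15238, route SosSandwich), line `birth` — AVERAGED potentials and the magnitude form of the machine reduction

Companion of `Theorems/SosSandwichTransferPBPotentialTree.lean` / `…MachineReductionPot.lean`. The potential a
query-magnitude machine uses has a special shape: a nonnegative per-bit, per-oracle quantity `f s y` (the query
magnitude of the oracle string `s` in the run of `F` on `x` with relevant oracle bits `y`), AVERAGED over the
completions of the current path `ρ` — `m_s(ρ) = E_y[f s (y ◁ ρ)]`, `y ◁ ρ` = `y` overridden along `ρ` — and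
summed over the FREE bits: `Φ(ρ) = Σ_{s ∉ dom ρ} m_s(ρ)`. For such potentials the drop hypothesis of the tree
analysis is AUTOMATIC: revealing a fresh bit `i` halves every `m_s` on average (`m_s(ρ·(i,0)) + m_s(ρ·(i,1)) =
2 m_s(ρ)`, a cube identity) and removes the term `s = i`, so `Φ(ρ·(i,0)) + Φ(ρ·(i,1)) = 2(Φ(ρ) − m_i(ρ))`. Hence a
machine that only ever picks FRESH bits with `m_i(ρ) ≥ τ` satisfies the potential hypotheses with drop `τ` and
`Φ([]) = Σ_s E_y[f s y]` (`= T`, the number of oracle gates, for query magnitudes).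

* `boolAvg_update_split` — `E_y[g(y|ᵢ₌₀)] + E_y[g(y|ᵢ₌₁)] = 2 E_y[g(y)]`;
* `avgOverride_split` — the halving identity for `m_s`;
* `freeSum_avgOverride_split` — the drop identity for `Φ`;
* `influence_restrictPath_eq_zero_of_mem` — revealed bits have influence `0` (refusals only concern free bits);
* **`oracleSimulation_of_magnitudeMachines`**, **`stub_pbOracleSimulation_of_magnitudeMachines`** — the stub
  from the machine hypothesis in MAGNITUDE FORM: the machine supplies `f ≥ 0`, `τ > 0`, a budget
  `D ≥ max(1, 2(Σ_s E f s)/(τδ))`, an advisor whose picks are fresh bits with `m_i(ρ) ≥ τ`, whose refusals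
  certify `Inf_i[p_x|_ρ] < w` for all `i` (for query magnitudes: the BBBV bound, the machine-prover's
  obligation), `1/20`-accurate leaf values, and computes the threshold bit of the advised tree.

All proved; def-free (the averaged quantities are written out); no named fact. Source: S. Aaronson, A. Ambainis,
Theory Comput. 10 (2014), Thm. 21/23 (arXiv:0911.0996v3 pp. 13–14); C. H. Bennett, E. Bernstein, G. Brassard,
U. Vazirani, SIAM J. Comput. 26 (1997), Thm. 3.3 (query magnitudes).
-/

-- D-0017: single-conjunct summit ⇒ the duplicate `QuantumAdvantage.QuantumAdvantage` is mandated.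
set_option linter.dupNamespace false

noncomputable section

namespace Summit.QuantumAdvantage.QuantumAdvantage.Cruxes.TransferPB.Birth

open Finset MeasureTheory Literature.Computability.Cryptography Literature.Computability.Complexity
  Literature.Computability.QuantumComplexity Literature.Computability.QuantumComplexity.ClassicalSimulation
open Summit.QuantumAdvantage.QuantumAdvantage.Theses.SosSandwich
open scoped ENNReal

namespace SimTreePB

section Cube

variable {M : ℕ}

/-- **Splitting an average on one bit**: `E_y[g(y|ᵢ₌₀)] + E_y[g(y|ᵢ₌₁)] = 2·E_y[g(y)]` (the pair
`{y|ᵢ₌₀, y|ᵢ₌₁}` is `{y, y ⊕ eᵢ}`). [folklore] -/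
theorem boolAvg_update_split (i : Fin M) (g : (Fin M → Bool) → ℝ) :
    boolAvg (fun y => g (Function.update y i false)) + boolAvg (fun y => g (Function.update y i true)) =
      2 * boolAvg g := by
  unfold boolAvg
  rw [← add_div, ← Finset.sum_add_distrib]
  have hpt : ∀ y : Fin M → Bool,
      g (Function.update y i false) + g (Function.update y i true) = g y + g (flipBit i y) := by
    intro y
    cases hy : y i
    · have h0 : Function.update y i false = y := by rw [← hy, Function.update_eq_self]
      have h1 : Function.update y i true = flipBit i y := by
        funext j; by_cases hj : j = i
        · subst hj; simp [flipBit, hy]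
        · simp [flipBit, hj]
      rw [h0, h1]
    · have h1 : Function.update y i true = y := by rw [← hy, Function.update_eq_self]
      have h0 : Function.update y i false = flipBit i y := by
        funext j; by_cases hj : j = i
        · subst hj; simp [flipBit, hy]
        · simp [flipBit, hj]
      rw [h0, h1, add_comm]
  rw [Finset.sum_congr rfl (fun y _ => hpt y), Finset.sum_add_distrib]
  have hflip : ∑ y : Fin M → Bool, g (flipBit i y) = ∑ y, g y :=
    Equiv.sum_comp (Function.Involutive.toPerm (flipBit i) (flipBit_flipBit i)) g
  rw [hflip]
  ring

/-- **Halving identity for averaged overrides**: with `y ◁ ρ := ρ.foldr (fun (i,b) z => z|ᵢ₌b) y`,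
`E_y[f((y ◁ ρ·(i,0)))] + E_y[f(y ◁ ρ·(i,1))] = 2·E_y[f(y ◁ ρ)]` for every path `ρ` and bit `i`. [folklore] -/
theorem avgOverride_split (f : (Fin M → Bool) → ℝ) (ρ : List (Fin M × Bool)) (i : Fin M) :
    boolAvg (fun y => f ((ρ ++ [(i, false)]).foldr (fun ib z => Function.update z ib.1 ib.2) y)) +
      boolAvg (fun y => f ((ρ ++ [(i, true)]).foldr (fun ib z => Function.update z ib.1 ib.2) y)) =
      2 * boolAvg (fun y => f (ρ.foldr (fun ib z => Function.update z ib.1 ib.2) y)) := by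
  simp only [List.foldr_append, List.foldr_cons, List.foldr_nil]
  exact boolAvg_update_split i (fun y => f (ρ.foldr (fun ib z => Function.update z ib.1 ib.2) y))

/-- **Drop identity for free-bit sums of averaged overrides.** For `i ∉ dom ρ`:
`Φ(ρ·(i,0)) + Φ(ρ·(i,1)) = 2(Φ(ρ) − m_i(ρ))`, where `Φ(ρ) = Σ_{s ∉ dom ρ} m_s(ρ)` and
`m_s(ρ) = E_y[f s (y ◁ ρ)]`. [folklore] -/
theorem freeSum_avgOverride_split (f : Fin M → (Fin M → Bool) → ℝ) (ρ : List (Fin M × Bool)) (i : Fin M)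
    (hi : i ∉ ρ.map Prod.fst) :
    (∑ s ∈ univ.filter (fun s => s ∉ (ρ ++ [(i, false)]).map Prod.fst),
        boolAvg (fun y => f s ((ρ ++ [(i, false)]).foldr (fun ib z => Function.update z ib.1 ib.2) y))) +
      (∑ s ∈ univ.filter (fun s => s ∉ (ρ ++ [(i, true)]).map Prod.fst),
        boolAvg (fun y => f s ((ρ ++ [(i, true)]).foldr (fun ib z => Function.update z ib.1 ib.2) y))) =
      2 * ((∑ s ∈ univ.filter (fun s => s ∉ ρ.map Prod.fst),
              boolAvg (fun y => f s (ρ.foldr (fun ib z => Function.update z ib.1 ib.2) y))) -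
            boolAvg (fun y => f i (ρ.foldr (fun ib z => Function.update z ib.1 ib.2) y))) := by
  have hset : ∀ b : Bool, (univ.filter fun s : Fin M => s ∉ (ρ ++ [(i, b)]).map Prod.fst) =
      (univ.filter fun s : Fin M => s ∉ ρ.map Prod.fst).erase i := by
    intro b
    ext s
    simp only [List.map_append, List.map_cons, List.map_nil, List.mem_append, List.mem_singleton,
      not_or, mem_filter, mem_univ, true_and, mem_erase]
    tauto
  rw [hset false, hset true, ← Finset.sum_add_distrib]
  have hi' : i ∈ univ.filter fun s : Fin M => s ∉ ρ.map Prod.fst := mem_filter.2 ⟨mem_univ _, hi⟩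
  rw [Finset.sum_congr rfl (fun s _ => avgOverride_split (f s) ρ i), ← Finset.mul_sum,
    ← Finset.add_sum_erase _ _ hi']
  ring

/-- **Revealed bits have no influence**: for `s ∈ dom ρ`, `Inf_s[p|_ρ] = 0` (the restriction ignores `x_s`). So a
machine's refusal clause "every influence is `< w`" only concerns the FREE bits. [folklore] -/
theorem influence_restrictPath_eq_zero_of_mem {N : ℕ} (s : Fin N) :
    ∀ (ρ : List (Fin N × Bool)) (p : MvPolynomial (Fin N) ℝ), s ∈ ρ.map Prod.fst →
      influence s (restrictPath ρ p) = 0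
  | [], _, h => by simp at h
  | e :: ρ, p, h => by
    rw [restrictPath_cons]
    by_cases hs : e.1 = s
    · refine influence_eq_zero_of_ignores (restrictPath_ignores ρ fun y => ?_)
      rw [← hs]
      exact evalBool_restrictPoly_flipBit e.1 e.2 p y
    · have h' : s ∈ ρ.map Prod.fst := by
        simp only [List.map_cons, List.mem_cons] at h
        rcases h with h | h
        · exact absurd h.symm hs
        · exact h
      exact influence_restrictPath_eq_zero_of_mem s ρ (restrictPoly e.1 e.2 p) h'

end Cube

/-! ### The reduction, magnitude form -/

/-- **`OracleSimulation` from the machine half, MAGNITUDE form.** Granted stub 1 and PB-AA: if for all `c k`,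
every uniform `F` and polynomial `r` there are one `Q ∈ PromiseBQP` and one polynomial-time transcript machine
`C` such that for every `x` (`n ≥ 1`) and every `g` correct on `Q`'s promise there are an advisor `Adv`, a
nonnegative per-bit quantity `f s y` on the relevant oracle bits, a threshold `τ > 0` and a budget
`D ≥ max(1, 2(Σ_s E_y f s y)/(τδ))` such that: every pick is a FRESH bit `i ∉ dom ρ` with averaged magnitude
`m_i(ρ) = E_y[f i (y ◁ ρ)] ≥ τ`; every refusal certifies `Inf_i[p_x|_ρ] < w` for all `i`; leaf values are
`1/20`-accurate; and `C^{A ⊕ g}(x)` is the threshold bit of `advTree Adv D` at the bits of `A` — at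
`δ = 1/(r(n)+1)`, `w = 2^{-k}(((1/10)²δ/2)/2/d)^c`, `d = thm23Degree F x` — then the average-case simulation
relative to the promise oracle holds with error `≤ 1/(r(n)+1)`. [cite: AaronsonAmbainis2014, Thm. 23 (proof, p. 14)] -/
theorem oracleSimulation_of_magnitudeMachines
    (hmach : ∀ (c k : ℕ) (F : QCircuitFamily cliffordT), F.IsUniform → ∀ r : Polynomial ℕ,
      ∃ Q ∈ Literature.Computability.Cryptography.PromiseBQP, ∃ (C : OracleAlg Bool) (q : Polynomial ℕ),
        C.IsPolyTime Computability.encodingBoolBool ∧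
        (∀ (O : Oracle) (x : List Bool), ∀ y ∈ C.queries O (q.eval x.length) x, y.length ≤ q.eval x.length) ∧
        ∀ x : List Bool, 1 ≤ x.length → ∀ g : List Bool → Bool,
          (∀ v ∈ Q.yes, g v = true) → (∀ v ∈ Q.no, g v = false) →
          ∃ (Adv : Advisor (numOracleBits F x))
            (f : Fin (numOracleBits F x) → (Fin (numOracleBits F x) → Bool) → ℝ) (τ : ℝ) (D : ℕ),
            0 < τ ∧ 0 < D ∧
            2 * (∑ s, boolAvg (f s)) / (τ * (1 / (((r.eval x.length : ℕ) : ℝ) + 1))) ≤ D ∧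
            (∀ s y, 0 ≤ f s y) ∧
            (∀ (ρ : List (Fin (numOracleBits F x) × Bool)) (i : Fin (numOracleBits F x)),
              Adv.pick ρ = some i → i ∉ ρ.map Prod.fst ∧
                τ ≤ boolAvg (fun y => f i (ρ.foldr (fun ib z => Function.update z ib.1 ib.2) y))) ∧
            (∀ ρ : List (Fin (numOracleBits F x) × Bool), Adv.pick ρ = none → ∀ i : Fin (numOracleBits F x),
              influence i (restrictPath ρ (acceptPoly F x)) <
                (1 / 2 ^ k : ℝ) * ((((1 / 10 : ℝ) ^ 2 * (1 / (((r.eval x.length : ℕ) : ℝ) + 1)) / 2) / 2) /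
                    thm23Degree F x) ^ c) ∧
            (∀ ρ : List (Fin (numOracleBits F x) × Bool),
              |Adv.val ρ - boolAvg (evalBool (restrictPath ρ (acceptPoly F x)))| ≤ 1 / 20) ∧
            ∀ A : Set (List Bool),
              C.run (Oracle.ofLanguage {w : List Bool | ∃ v : List Bool,
                  (w = false :: v ∧ v ∈ A) ∨ (w = true :: v ∧ g v = true)}) (q.eval x.length) x =
                some (decide (1 / 2 ≤ (advTree Adv D []).eval (oracleBits F x A)))) :
    Sig.stub_oracleAcceptPseudoBounded → PseudoBoundedAA → OracleSimulation := by
  refine oracleSimulation_of_potentialMachines fun c k F hF r => ?_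
  obtain ⟨Q, hQ, C, q, hCpoly, hCq, hC⟩ := hmach c k F hF r
  refine ⟨Q, hQ, C, q, hCpoly, hCq, fun x hx g hgy hgn => ?_⟩
  obtain ⟨Adv, f, τ, D, hτ, hD0, hD, hf0, hpick, hnone, hval, hrun⟩ := hC x hx g hgy hgn
  -- the averaged free-bit potential
  let Φ : List (Fin (numOracleBits F x) × Bool) → ℝ := fun ρ =>
    ∑ s ∈ univ.filter (fun s => s ∉ ρ.map Prod.fst),
      boolAvg (fun y => f s (ρ.foldr (fun ib z => Function.update z ib.1 ib.2) y))
  have hfilt : (univ.filter fun s : Fin (numOracleBits F x) =>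
      s ∉ ([] : List (Fin (numOracleBits F x) × Bool)).map Prod.fst) = univ :=
    Finset.filter_true_of_mem fun s _ => by simp
  have hΦnil : Φ [] = ∑ s, boolAvg (f s) := by
    show (∑ s ∈ univ.filter (fun s => s ∉ ([] : List (Fin (numOracleBits F x) × Bool)).map Prod.fst),
      boolAvg (fun y => f s (([] : List (Fin (numOracleBits F x) × Bool)).foldr
        (fun ib z => Function.update z ib.1 ib.2) y))) = _
    rw [hfilt]
    rfl
  refine ⟨Adv, Φ, τ, D, hτ, hD0, by rw [hΦnil]; exact hD, fun ρ i h => (hpick ρ i h).1, fun ρ => ?_,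
    fun ρ i h => ?_, hnone, hval, hrun⟩
  · exact Finset.sum_nonneg fun s _ => boolAvg_nonneg fun y => hf0 s _
  · obtain ⟨hfresh, hτle⟩ := hpick ρ i h
    have hsplit := freeSum_avgOverride_split f ρ i hfresh
    simp only [Φ]
    linarith

/-- **Stub `stub_pbOracleSimulation` from its machine, magnitude form** (see
`oracleSimulation_of_magnitudeMachines`; the intended `f` is the query magnitude of the oracle string named by
the bit, its refusal clause the BBBV bound). [cite: AaronsonAmbainis2014, Thm. 23 (proof, p. 14)] -/
theorem stub_pbOracleSimulation_of_magnitudeMachines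
    (hmach : ∀ (c k : ℕ) (F : QCircuitFamily cliffordT), F.IsUniform → ∀ r : Polynomial ℕ,
      ∃ Q ∈ Literature.Computability.Cryptography.PromiseBQP, ∃ (C : OracleAlg Bool) (q : Polynomial ℕ),
        C.IsPolyTime Computability.encodingBoolBool ∧
        (∀ (O : Oracle) (x : List Bool), ∀ y ∈ C.queries O (q.eval x.length) x, y.length ≤ q.eval x.length) ∧
        ∀ x : List Bool, 1 ≤ x.length → ∀ g : List Bool → Bool,
          (∀ v ∈ Q.yes, g v = true) → (∀ v ∈ Q.no, g v = false) →
          ∃ (Adv : Advisor (numOracleBits F x))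
            (f : Fin (numOracleBits F x) → (Fin (numOracleBits F x) → Bool) → ℝ) (τ : ℝ) (D : ℕ),
            0 < τ ∧ 0 < D ∧
            2 * (∑ s, boolAvg (f s)) / (τ * (1 / (((r.eval x.length : ℕ) : ℝ) + 1))) ≤ D ∧
            (∀ s y, 0 ≤ f s y) ∧
            (∀ (ρ : List (Fin (numOracleBits F x) × Bool)) (i : Fin (numOracleBits F x)),
              Adv.pick ρ = some i → i ∉ ρ.map Prod.fst ∧
                τ ≤ boolAvg (fun y => f i (ρ.foldr (fun ib z => Function.update z ib.1 ib.2) y))) ∧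
            (∀ ρ : List (Fin (numOracleBits F x) × Bool), Adv.pick ρ = none → ∀ i : Fin (numOracleBits F x),
              influence i (restrictPath ρ (acceptPoly F x)) <
                (1 / 2 ^ k : ℝ) * ((((1 / 10 : ℝ) ^ 2 * (1 / (((r.eval x.length : ℕ) : ℝ) + 1)) / 2) / 2) /
                    thm23Degree F x) ^ c) ∧
            (∀ ρ : List (Fin (numOracleBits F x) × Bool),
              |Adv.val ρ - boolAvg (evalBool (restrictPath ρ (acceptPoly F x)))| ≤ 1 / 20) ∧
            ∀ A : Set (List Bool),
              C.run (Oracle.ofLanguage {w : List Bool | ∃ v : List Bool,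
                  (w = false :: v ∧ v ∈ A) ∨ (w = true :: v ∧ g v = true)}) (q.eval x.length) x =
                some (decide (1 / 2 ≤ (advTree Adv D []).eval (oracleBits F x A)))) :
    Sig.stub_pbOracleSimulation :=
  oracleSimulation_of_magnitudeMachines hmach

end SimTreePB

end Summit.QuantumAdvantage.QuantumAdvantage.Cruxes.TransferPB.Birth

end
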